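import Summits.ResolutionOfSingularities.ResolutionOfSingularities.Theorems.WeightedInvariantIota3Regimes
import Summits.ResolutionOfSingularities.ResolutionOfSingularities.Theorems.WeightedInvariantP3bDrop
import Summits.ResolutionOfSingularities.ResolutionOfSingularities.Theorems.WeightedInvariantHypersurfaceLocalGameEFT4SDimLETwoGameTerminal
import HarnessLib

/-!
# The position regimes of the local engine, II: the (drop) conjunct per regime — P3d statement and the divisorial vacuity

W4.3 hypersurface-centre programme, crux `HypersurfaceCentreConstruction` (stmt-ResolutionOfSingularities-19897), local engine
(stmt-ResolutionOfSingularities-8899); ORDER (o38) «REGIMES + P3d» of res-L1-w43-plan-1, part 2 (part 1 =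
`WeightedInvariantIota3Regimes`, p530450: the regime predicates and the (R1)/(R2) dichotomies).

Contents (namespace `…LocalEngine.Iota3`):
* (R3) **P3d, STATEMENT ONLY**: `P3dDropOf Tame ι p` — at a tame CROSSING position (`IsCrossingPosition S f`, `ε = 1`) of a regular local
  ring of dimension `≤ 3`, for every σ-maximiser two-flag (res-D-pv-061's `IsSigmaMaximiser`, p529577) completed to a regular system of
  parameters `(x, g₂, g₁)` with primitive weights `(q, r₂, r₁)`, the weighted blow-up of `𝔪` so presented satisfies the (drop) conjunct
  `WeightedDrop ι S f 𝔪 ![x, g₂, g₁] ![q, r₂, r₁]`.  Same centre rule as P3b (`P3bDropOf`, whose isolation hypothesis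
  `topStratum iotaOrd S f = V(𝔪)` is replaced by `IsCrossingPosition S f`), a SEPARATE name because the expected drop mechanism differs
  (ν drops or `ε' = 0` at every tied successor; σ only if ε ties at 1) and it is separately killable.  `P3dDrop Tame p := P3dDropOf Tame iotaFlat p`.
  Packaging: `weightedDrop_of_isPointCentrePosition` — P3b ∧ P3d give the (drop) conjunct at every tame POINT-centre position.
* **Divisorial vacuity** (regime `IsDivisorialPosition`): for `f = c · π^ν` (`c` a unit, `π` a regular parameter — the shape part 1's
  `exists_eq_unit_mul_pow_of_isDivisorialPosition` provides) the (drop) sentence of the divisor centre presented by `u = (x, y, π)`,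
  `w = (0, 0, 1)` holds VACUOUSLY for every invariant `ι` and every `P`: off the vertex the transform `g` is a unit, so `g ∉ 𝔪_𝔫²`
  (res-type-098's `LocalGameEFTDimTwoGame.isUnit_transform_of_monomialType'`, the `dim ≤ 2` case-A argument, which is dimension-free).
  Corollary `exists_weightedDrop_of_isDivisorialPosition`.

All `def`s here are predicates OF THE LINE ([OURS]), not cited statements; the proofs are folklore commutative algebra.
References: [cite: AbramovichTemkinWlodarczyk2024, §5 (weighted centre and drop of the invariant)]; [cite: Wlodarczyk2022, §2.1 (cobordant
blow-up `B = S[t⁻¹, u₁ t^{w₁}, …]`)].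
-/

open IsLocalRing Literature.AlgebraicGeometry.Resolution
open Summit.ResolutionOfSingularities.ResolutionOfSingularities.Theorems

set_option linter.dupNamespace false -- mandated namespace of this single-conjunct summit

namespace Summit.ResolutionOfSingularities.ResolutionOfSingularities.Cruxes.HypersurfaceCentreConstruction.LocalEngine

namespace Iota3

variable {S : Type} [CommRing S]

/-! ## (R3) P3d — the (drop) conjunct at a tame crossing position, STATEMENT ONLY -/

/-- [OURS · (o38) (R3)] **(P3d-drop) for a tameness cut `Tame` and an invariant `ι`, residue characteristic `p`** — a predicate of the
line, not a cited statement.  For every perfect ground field `k₀` of characteristic `p`, every regular local `S` essentially of finite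
type over `k₀` with `dim S ≤ 3`, every `0 ≠ f ∈ 𝔪²` such that
* the position is CROSSING, `IsCrossingPosition S f` (`ε(S, f) = 1`: the equimultiple locus is not a permissible centre),
* the position is `Tame S f`,
and for every σ-attaining two-flag `(g₁, g₂; q, r₁, r₂)` of `f` (order `ν = iotaOrd S f`) completed by `x` to a regular system of
parameters `(x, g₂, g₁)` of `S` (so `dim S = 3`) with PRIMITIVE weight vector `(q, r₂, r₁)`: the weighted blow-up of the centre `𝔪`
presented by `u = (x, g₂, g₁)`, `w = (q, r₂, r₁)` satisfies the (drop) conjunct for `ι` — `WeightedDrop ι S f 𝔪 ![x, g₂, g₁] ![q, r₂, r₁]`.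
Same centre rule as `P3bDropOf` (isolation hypothesis replaced by `IsCrossingPosition`); kept under a separate name because the expected
drop mechanism differs and the clause is separately killable.  NOT in print as a theorem in characteristic `p`. -/
def P3dDropOf (Tame : (R : Type) → [CommRing R] → R → Prop) (ι : (R : Type) → [CommRing R] → R → Ordinal.{0}) (p : ℕ) : Prop :=
  ∀ (k₀ : Type) [Field k₀] [CharP k₀ p] [PerfectField k₀]
    (S : Type) [CommRing S] [Algebra k₀ S] [Algebra.EssFiniteType k₀ S] [IsRegularLocalRing S] (f : S),
    ringKrullDim S ≤ 3 → f ≠ 0 → f ∈ (maximalIdeal S) ^ 2 →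
    IsCrossingPosition S f →
    Tame S f →
    ∀ (ν : ℕ), iotaOrd S f = ν →
    ∀ (x g₁ g₂ : S) (q r₁ r₂ : ℕ),
      Ideal.span {x, g₂, g₁} = maximalIdeal S → (maximalIdeal S).spanFinrank = 3 →
      IsSigmaMaximiser f ν g₁ g₂ q r₁ r₂ →
      (∀ d : ℕ, d ∣ q → d ∣ r₁ → d ∣ r₂ → d = 1) →
      WeightedDrop ι S f (maximalIdeal S) ![x, g₂, g₁] ![q, r₂, r₁]

/-- A STRONGER tameness cut gives a WEAKER (P3d-drop): `(∀ S f, Tame' S f → Tame S f) → P3dDropOf Tame ι p → P3dDropOf Tame' ι p`.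
[folklore] -/
theorem P3dDropOf.mono_tame {Tame Tame' : (R : Type) → [CommRing R] → R → Prop}
    (hT : ∀ (R : Type) [CommRing R] (g : R), Tame' R g → Tame R g) {ι : (R : Type) → [CommRing R] → R → Ordinal.{0}} {p : ℕ}
    (h : P3dDropOf Tame ι p) : P3dDropOf Tame' ι p :=
  fun k₀ _ _ _ S _ _ _ _ f hdim hf0 hf2 hcross htame ν hν x g₁ g₂ q r₁ r₂ hspan hrk hmax hprim =>
    h k₀ S f hdim hf0 hf2 hcross (hT S f htame) ν hν x g₁ g₂ q r₁ r₂ hspan hrk hmax hprim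

/-- Modus ponens at a position: (P3d-drop) gives the (drop) conjunct text for the exact-flag-weight centre at a tame crossing point.
[folklore] -/
theorem P3dDropOf.drop {Tame : (R : Type) → [CommRing R] → R → Prop} {ι : (R : Type) → [CommRing R] → R → Ordinal.{0}} {p : ℕ}
    (h : P3dDropOf Tame ι p) (k₀ : Type) [Field k₀] [CharP k₀ p] [PerfectField k₀]
    (S : Type) [CommRing S] [Algebra k₀ S] [Algebra.EssFiniteType k₀ S] [IsRegularLocalRing S] (f : S)
    (hdim : ringKrullDim S ≤ 3) (hf0 : f ≠ 0) (hf2 : f ∈ (maximalIdeal S) ^ 2)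
    (hcross : IsCrossingPosition S f) (htame : Tame S f)
    {ν : ℕ} (hν : iotaOrd S f = ν) {x g₁ g₂ : S} {q r₁ r₂ : ℕ}
    (hspan : Ideal.span {x, g₂, g₁} = maximalIdeal S) (hrk : (maximalIdeal S).spanFinrank = 3)
    (hmax : IsSigmaMaximiser f ν g₁ g₂ q r₁ r₂) (hprim : ∀ d : ℕ, d ∣ q → d ∣ r₁ → d ∣ r₂ → d = 1) :
    WeightedDrop ι S f (maximalIdeal S) ![x, g₂, g₁] ![q, r₂, r₁] :=
  h k₀ S f hdim hf0 hf2 hcross htame ν hν x g₁ g₂ q r₁ r₂ hspan hrk hmax hprim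

/-- [OURS · (o38) (R3)] **(P3d-drop) OF RECORD**: `P3dDrop Tame p := P3dDropOf Tame iotaFlat p` — the (drop) conjunct at tame crossing
positions for the P3 invariant with generic reading `iotaFlat = (ν ; ε ; σ)` (res-D-pv-061, p529577); a predicate of the line, not a
cited statement. -/
def P3dDrop (Tame : (R : Type) → [CommRing R] → R → Prop) (p : ℕ) : Prop :=
  P3dDropOf Tame iotaFlat p

/-- `P3dDrop` unfolded. [folklore] -/
theorem p3dDrop_iff (Tame : (R : Type) → [CommRing R] → R → Prop) (p : ℕ) :
    P3dDrop Tame p ↔ P3dDropOf Tame iotaFlat p :=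
  Iff.rfl

/-- A stronger tameness cut gives a weaker `P3dDrop`. [folklore] -/
theorem P3dDrop.mono_tame {Tame Tame' : (R : Type) → [CommRing R] → R → Prop}
    (hT : ∀ (R : Type) [CommRing R] (g : R), Tame' R g → Tame R g) {p : ℕ} (h : P3dDrop Tame p) : P3dDrop Tame' p :=
  P3dDropOf.mono_tame hT h

/-! ## Packaging: P3b ∧ P3d give the (drop) conjunct at every tame point-centre position -/

/-- [folklore · (o38)] At a tame POINT-centre position (`IsPointCentrePosition S f`: the generic point of the top `(ν, ε)`-stratum is
the closed point) of a regular local ring of dimension `≤ 3`, (P3b-drop) and (P3d-drop) together give the (drop) conjunct for every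
exact-flag-weight centre: the position is isolated or crossing (part 1, `isPointCentrePosition_iff_isolated_or_crossing`), and the
matching clause applies. -/
theorem weightedDrop_of_isPointCentrePosition {Tame : (R : Type) → [CommRing R] → R → Prop}
    {ι : (R : Type) → [CommRing R] → R → Ordinal.{0}} {p : ℕ} (hb : P3bDropOf Tame ι p) (hd : P3dDropOf Tame ι p)
    (k₀ : Type) [Field k₀] [CharP k₀ p] [PerfectField k₀]
    (S : Type) [CommRing S] [Algebra k₀ S] [Algebra.EssFiniteType k₀ S] [IsRegularLocalRing S] (f : S)
    (hdim : ringKrullDim S ≤ 3) (hf0 : f ≠ 0) (hf2 : f ∈ (maximalIdeal S) ^ 2)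
    (hpt : IsPointCentrePosition S f) (htame : Tame S f)
    {ν : ℕ} (hν : iotaOrd S f = ν) {x g₁ g₂ : S} {q r₁ r₂ : ℕ}
    (hspan : Ideal.span {x, g₂, g₁} = maximalIdeal S) (hrk : (maximalIdeal S).spanFinrank = 3)
    (hmax : IsSigmaMaximiser f ν g₁ g₂ q r₁ r₂) (hprim : ∀ d : ℕ, d ∣ q → d ∣ r₁ → d ∣ r₂ → d = 1) :
    WeightedDrop ι S f (maximalIdeal S) ![x, g₂, g₁] ![q, r₂, r₁] := by
  have hf : f ∈ maximalIdeal S := Ideal.pow_le_self two_ne_zero hf2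
  rcases (isPointCentrePosition_iff_isolated_or_crossing hdim hf0 hf).mp hpt with hiso | hcross
  · exact hb.drop k₀ S f hdim hf0 hf2 hiso htame hν hspan hrk hmax hprim
  · exact hd.drop k₀ S f hdim hf0 hf2 hcross htame hν hspan hrk hmax hprim

/-! ## The divisorial regime: the (drop) sentence of the divisor centre is vacuous -/

/-- `(0, 0, 1) = e₂` in `Fin 3 → ℕ`. [folklore] -/
theorem vecCons_zero_zero_one_eq_single : (![0, 0, 1] : Fin 3 → ℕ) = Pi.single (2 : Fin 3) 1 := by
  ext i; fin_cases i <;> simp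

/-- The filtration of the divisor-centre presentation `u = (x, y, π)`, `w = (0, 0, 1)` IS the one-element chart's `n ↦ (πⁿ)`:
the weight-zero parameters do not constrain the monomials. [cite: Wlodarczyk2022, Lemma 2.1.12] -/
theorem weightedMonomialIdeal_vecCons_zero_zero_one_eq_one (x y π : S) :
    weightedMonomialIdeal ![x, y, π] ![0, 0, 1] = weightedMonomialIdeal (fun _ : Fin 1 => π) (fun _ => 1) := by
  rw [vecCons_zero_zero_one_eq_single, LocalGameEFTCurveMove.weightedMonomialIdeal_single_eq_one]
  rfl

/-- The filtration of the divisor-centre presentation is `n ↦ (π)ⁿ`. [cite: Wlodarczyk2022, Lemma 2.1.12] -/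
theorem weightedMonomialIdeal_vecCons_zero_zero_one (x y π : S) (m : ℕ) :
    weightedMonomialIdeal ![x, y, π] ![0, 0, 1] m = Ideal.span {π} ^ m := by
  rw [vecCons_zero_zero_one_eq_single, LocalGameEFTCurveMove.weightedMonomialIdeal_single_eq, Ideal.span_singleton_pow]
  rfl

/-- [folklore · (o38)] **Divisorial vacuity of the (drop) sentence.**  If `f = c · π^ν` with `c` a unit and `π` a regular parameter
(`π ∈ 𝔪 ∖ 𝔪²`) of a regular local ring `S`, then for the divisor centre presented by `u = (x, y, π)`, `w = (0, 0, 1)` — whatever the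
weight-zero entries `x, y`, the ideal `P` and the invariant `ι` — the (drop) sentence `WeightedDrop ι S f P u w` holds VACUOUSLY: at a
prime `𝔫` of the cobordant algebra off the vertex the transform `g` of `f` is a unit (res-type-098's
`isUnit_transform_of_monomialType'`), so the hypothesis `g ∈ 𝔪_𝔫²` of the sentence is never met. -/
theorem weightedDrop_of_eq_unit_mul_pow [IsRegularLocalRing S] (ι : (R : Type) → [CommRing R] → R → Ordinal.{0}) {f c π : S}
    (hπ : π ∈ maximalIdeal S) (hπ2 : π ∉ maximalIdeal S ^ 2) (hc : IsUnit c) {ν : ℕ} (hf : f = c * π ^ ν) (P : Ideal S)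
    (x y : S) : WeightedDrop ι S f P ![x, y, π] ![0, 0, 1] := by
  subst hf
  intro 𝔫 _ _ _ hV a g hfg hndvd hg2
  have hu : IsUnit (algebraMap _ (Localization.AtPrime 𝔫) g) :=
    LocalGameEFTDimTwoGame.isUnit_transform_of_monomialType' hπ hπ2 hc ν
      (weightedMonomialIdeal_vecCons_zero_zero_one_eq_one x y π) 𝔫 hV hfg hndvd
  exact absurd hu (mem_nonunits_iff.mp ((mem_maximalIdeal _).mp (Ideal.pow_le_self two_ne_zero hg2)))

/-- [folklore · (o38)] **The divisorial regime needs no invariant drop.**  At a DIVISORIAL position (`IsDivisorialPosition S f`) of a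
regular local ring of dimension `≤ 3` with `0 ≠ f ∈ 𝔪`, the top `(ν, ε)`-stratum's generic point is a principal prime `(π)` with `π` a
regular parameter and `f = c · π^ν` (part 1), and the (drop) sentence of the divisor centre `P₀ = (π)` presented by `(x, y, π; 0, 0, 1)`
holds vacuously for EVERY invariant `ι` and every choice of the weight-zero entries. -/
theorem exists_weightedDrop_of_isDivisorialPosition [IsRegularLocalRing S] (hdim : ringKrullDim S ≤ 3) {f : S} (hf0 : f ≠ 0)
    (hf : f ∈ maximalIdeal S) (h : IsDivisorialPosition S f) :
    ∃ π : S, π ∈ maximalIdeal S ∧ π ∉ maximalIdeal S ^ 2 ∧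
      ContactCylinder.topStratumPrime iotaOrdEps S f = Ideal.span {π} ∧
      ∀ (ι : (R : Type) → [CommRing R] → R → Ordinal.{0}) (x y : S),
        WeightedDrop ι S f (ContactCylinder.topStratumPrime iotaOrdEps S f) ![x, y, π] ![0, 0, 1] := by
  obtain ⟨c, π, hc, hπ, hπ2, hfe, hP⟩ := exists_eq_unit_mul_pow_of_isDivisorialPosition hdim hf0 hf h
  exact ⟨π, hπ, hπ2, hP, fun ι x y => weightedDrop_of_eq_unit_mul_pow ι hπ hπ2 hc hfe _ x y⟩

end Iota3

end Summit.ResolutionOfSingularities.ResolutionOfSingularities.Cruxes.HypersurfaceCentreConstruction.LocalEngine
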